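import Mathlib
import Literature.Barriers.AtomisticToContinuum.OneDimensionalHardCoreFamilies

/-!
# `HonestZwanzig.RobinCoercivity`, line `limit-operator-memory-form` — stub `stub_toeplitzSymbol`

Support file (`--supports` the crux `RobinCoercivity`, stmt-AtomisticToContinuum-12695, of route `HonestZwanzig`,
sub-problem `FouriersLaw`). Pure real/Fourier analysis; no project definitions are used.

TOEPLITZ SECTIONS ARE BOUNDED BELOW BY THE BOTTOM OF THE SYMBOL. For a summable kernel `K : ℤ → ℝ` whose cosine
symbol `K̂(θ) = Σ'_z K(z) cos(zθ)` is `> 0` at EVERY `θ`, there is `m > 0` with `Σ_{i,j} v_i K(i−j) v_j ≥ m·|v|²`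
for every finite section (all `M`, all `v : Fin M → ℝ`), see `stub_toeplitzSymbol`.

Proof. `K̂` is continuous (the cosine series converges uniformly because `K` is absolutely summable), so on the
compact interval `[0, 2π]` it attains its minimum `m = K̂(θ₀) > 0` (compactness of the period turns pointwise
positivity into a uniform constant). Orthogonality of the cosines `cos(nθ)`, `n ∈ ℤ`, on `[0, 2π]` and termwise
integration of the absolutely convergent series give the Fourier coefficients
`∫₀^{2π} K̂(θ) cos(nθ) dθ = π (K(n) + K(−n))`. With the nonnegative trigonometric polynomial
`P_v(θ) = Σ_{i,j} v_i v_j cos((i−j)θ) = (Σ_i v_i cos(iθ))² + (Σ_i v_i sin(iθ))²` this yields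
`∫₀^{2π} K̂ P_v = 2π Σ_{i,j} v_i K(i−j) v_j` and `∫₀^{2π} P_v = 2π |v|²`, whence, integrating `K̂ P_v ≥ m P_v`,
`2π Σ_{i,j} v_i K(i−j) v_j ≥ 2π m |v|²`. [Halmos1982 Problem/Solution 250 (Hartman–Wintner); Grenander–Szegő,
Toeplitz Forms §5.2; folklore]
-/

noncomputable section

open MeasureTheory Finset

namespace Summit.AtomisticToContinuum.FouriersLaw.Theorems.HonestZwanzig.Robin

/-! ### Trigonometric integrals over one period

The orthogonality relations `∫₀^{2π} cos(kθ) dθ = 2π·[k = 0]` (`integral_cos_int_mul_two_pi`) and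
`∫₀^{2π} cos(mθ)cos(m'θ) dθ = π([m = m'] + [m + m' = 0])` (`integral_cos_mul_cos`) are reused from
`Literature.Barriers.AtomisticToContinuum.OneDimensionalHardCoreFamilies` (namespace `…BoseGas`). -/

open Literature.Barriers.AtomisticToContinuum.BoseGas (integral_cos_int_mul_two_pi integral_cos_mul_cos)

/-! ### The cosine symbol of a summable kernel -/

variable {K : ℤ → ℝ}

/-- The cosine symbol `θ ↦ Σ'_z K(z) cos(zθ)` of a summable kernel is continuous (the series is dominated by the
summable sequence `|K z|`, hence converges uniformly). [folklore] -/
theorem continuous_cosSymbol (hK : Summable K) :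
    Continuous fun θ : ℝ => ∑' z : ℤ, K z * Real.cos (z * θ) := by
  refine continuous_tsum (fun z => by fun_prop) hK.abs fun z θ => ?_
  rw [Real.norm_eq_abs, abs_mul]
  exact mul_le_of_le_one_right (abs_nonneg _) (Real.abs_cos_le_one _)

/-- Fourier coefficients of the cosine symbol: `∫₀^{2π} K̂(θ) cos(nθ) dθ = π (K(n) + K(−n))` for every integer `n`
(termwise integration of the absolutely convergent series, then orthogonality). [folklore] -/
theorem integral_cosSymbol_mul_cos (hK : Summable K) (n : ℤ) :
    ∫ θ in (0 : ℝ)..2 * Real.pi, (∑' z : ℤ, K z * Real.cos (z * θ)) * Real.cos (n * θ) =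
      Real.pi * (K n + K (-n)) := by
  have h2π : (0 : ℝ) ≤ 2 * Real.pi := by positivity
  simp_rw [← tsum_mul_right]
  -- the integral of each term
  have hterm : ∀ z : ℤ, ∫ θ in (0 : ℝ)..2 * Real.pi, K z * Real.cos (z * θ) * Real.cos (n * θ) =
      (if z = n then K n * Real.pi else 0) + (if z = -n then K (-n) * Real.pi else 0) := by
    intro z
    simp_rw [mul_assoc]
    rw [intervalIntegral.integral_const_mul, integral_cos_mul_cos]
    simp only [add_eq_zero_iff_eq_neg]
    split_ifs with h1 h2 h2
    · rw [h1] at h2 ⊢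
      rw [← h2]
      ring
    · rw [h1]
      ring
    · rw [h2]
      ring
    · ring
  -- each term is integrable on the period, with summable `L¹` norms
  have hint : ∀ z : ℤ, Integrable (fun θ : ℝ => K z * Real.cos (z * θ) * Real.cos (n * θ))
      (volume.restrict (Set.Ioc 0 (2 * Real.pi))) := fun z =>
    (by fun_prop : Continuous fun θ : ℝ => K z * Real.cos (z * θ) * Real.cos (n * θ)).integrableOn_Ioc
  have hsum : Summable fun z : ℤ =>
      ∫ θ in Set.Ioc 0 (2 * Real.pi), ‖K z * Real.cos (z * θ) * Real.cos (n * θ)‖ := by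
    refine Summable.of_nonneg_of_le (fun z => integral_nonneg fun _ => norm_nonneg _) (fun z => ?_)
      (hK.abs.mul_right (2 * Real.pi))
    rw [← intervalIntegral.integral_of_le h2π]
    have hb := intervalIntegral.norm_integral_le_of_norm_le_const (a := (0 : ℝ)) (b := 2 * Real.pi)
      (C := |K z|) (f := fun θ => ‖K z * Real.cos (z * θ) * Real.cos (n * θ)‖) (fun θ _ => ?_)
    · rw [sub_zero, abs_of_nonneg h2π, Real.norm_eq_abs] at hb
      exact (le_abs_self _).trans hb
    · rw [norm_norm, Real.norm_eq_abs, abs_mul, abs_mul, mul_assoc]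
      exact mul_le_of_le_one_right (abs_nonneg _)
        (mul_le_one₀ (Real.abs_cos_le_one _) (abs_nonneg _) (Real.abs_cos_le_one _))
  have key := integral_tsum_of_summable_integral_norm hint hsum
  rw [intervalIntegral.integral_of_le h2π, ← key]
  simp_rw [← intervalIntegral.integral_of_le h2π, hterm]
  rw [((hasSum_ite_eq n (K n * Real.pi)).add (hasSum_ite_eq (-n) (K (-n) * Real.pi))).tsum_eq]
  ring

/-! ### The quadratic form of a finite Toeplitz section as an integral against the symbol -/

/-- The trigonometric polynomial `P_v(θ) = Σ_{i,j} v_i v_j cos((i−j)θ)` equals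
`(Σ_i v_i cos(iθ))² + (Σ_i v_i sin(iθ))²`, hence is nonnegative. [folklore] -/
theorem toeplitz_quadForm_cos_nonneg {M : ℕ} (v : Fin M → ℝ) (θ : ℝ) :
    0 ≤ ∑ i : Fin M, ∑ j : Fin M,
      v i * v j * Real.cos (((((i : ℕ) : ℤ) - ((j : ℕ) : ℤ) : ℤ) : ℝ) * θ) := by
  have h : ∑ i : Fin M, ∑ j : Fin M, v i * v j * Real.cos (((((i : ℕ) : ℤ) - ((j : ℕ) : ℤ) : ℤ) : ℝ) * θ)
      = (∑ i : Fin M, v i * Real.cos ((i : ℝ) * θ)) ^ 2 +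
        (∑ i : Fin M, v i * Real.sin ((i : ℝ) * θ)) ^ 2 := by
    rw [sq, sq, Finset.sum_mul_sum, Finset.sum_mul_sum, ← Finset.sum_add_distrib]
    refine Finset.sum_congr rfl fun i _ => ?_
    rw [← Finset.sum_add_distrib]
    refine Finset.sum_congr rfl fun j _ => ?_
    push_cast
    rw [sub_mul, Real.cos_sub]
    ring
  rw [h]
  positivity

/-- `∫₀^{2π} P_v(θ) dθ = 2π |v|²` for `P_v(θ) = Σ_{i,j} v_i v_j cos((i−j)θ)` (only the diagonal survives).
[folklore] -/
theorem integral_toeplitz_quadForm_cos {M : ℕ} (v : Fin M → ℝ) :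
    ∫ θ in (0 : ℝ)..2 * Real.pi, ∑ i : Fin M, ∑ j : Fin M,
        v i * v j * Real.cos (((((i : ℕ) : ℤ) - ((j : ℕ) : ℤ) : ℤ) : ℝ) * θ) =
      2 * Real.pi * ∑ i : Fin M, v i ^ 2 := by
  rw [intervalIntegral.integral_finsetSum (fun i _ => ?_)]
  · have hinner : ∀ i : Fin M, ∫ θ in (0 : ℝ)..2 * Real.pi, ∑ j : Fin M,
        v i * v j * Real.cos (((((i : ℕ) : ℤ) - ((j : ℕ) : ℤ) : ℤ) : ℝ) * θ) =
        v i * v i * (2 * Real.pi) := by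
      intro i
      rw [intervalIntegral.integral_finsetSum (fun j _ => ?_)]
      · simp_rw [intervalIntegral.integral_const_mul, integral_cos_int_mul_two_pi, sub_eq_zero,
          Nat.cast_inj, Fin.val_inj, mul_ite, mul_zero]
        rw [Finset.sum_ite_eq]
        simp
      · exact (by fun_prop : Continuous fun θ : ℝ =>
          v i * v j * Real.cos (((((i : ℕ) : ℤ) - ((j : ℕ) : ℤ) : ℤ) : ℝ) * θ)).intervalIntegrable _ _
    simp_rw [hinner]
    rw [Finset.mul_sum]
    refine Finset.sum_congr rfl fun i _ => ?_
    ring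
  · exact (by fun_prop : Continuous fun θ : ℝ => ∑ j : Fin M,
      v i * v j * Real.cos (((((i : ℕ) : ℤ) - ((j : ℕ) : ℤ) : ℤ) : ℝ) * θ)).intervalIntegrable _ _

/-- `∫₀^{2π} K̂(θ) P_v(θ) dθ = 2π Σ_{i,j} v_i K(i−j) v_j` for the cosine symbol `K̂` of a summable kernel `K` and
`P_v(θ) = Σ_{i,j} v_i v_j cos((i−j)θ)`: the quadratic form of a finite Toeplitz section only sees the even part of
the kernel, whose Fourier series is `K̂`. [folklore] -/
theorem integral_cosSymbol_mul_toeplitz_quadForm (hK : Summable K) {M : ℕ} (v : Fin M → ℝ) :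
    ∫ θ in (0 : ℝ)..2 * Real.pi, (∑' z : ℤ, K z * Real.cos (z * θ)) *
        ∑ i : Fin M, ∑ j : Fin M, v i * v j * Real.cos (((((i : ℕ) : ℤ) - ((j : ℕ) : ℤ) : ℤ) : ℝ) * θ) =
      2 * Real.pi * ∑ i : Fin M, ∑ j : Fin M, v i * K (((i : ℕ) : ℤ) - ((j : ℕ) : ℤ)) * v j := by
  have hSc := continuous_cosSymbol hK
  have hdist : ∀ θ : ℝ, (∑' z : ℤ, K z * Real.cos (z * θ)) *
      ∑ i : Fin M, ∑ j : Fin M, v i * v j * Real.cos (((((i : ℕ) : ℤ) - ((j : ℕ) : ℤ) : ℤ) : ℝ) * θ) =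
      ∑ i : Fin M, ∑ j : Fin M, v i * v j * ((∑' z : ℤ, K z * Real.cos (z * θ)) *
        Real.cos (((((i : ℕ) : ℤ) - ((j : ℕ) : ℤ) : ℤ) : ℝ) * θ)) := by
    intro θ
    rw [Finset.mul_sum]
    refine Finset.sum_congr rfl fun i _ => ?_
    rw [Finset.mul_sum]
    refine Finset.sum_congr rfl fun j _ => ?_
    ring
  simp_rw [hdist]
  rw [intervalIntegral.integral_finsetSum (fun i _ => ?_)]
  · have hinner : ∀ i : Fin M, ∫ θ in (0 : ℝ)..2 * Real.pi, ∑ j : Fin M, v i * v j *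
        ((∑' z : ℤ, K z * Real.cos (z * θ)) * Real.cos (((((i : ℕ) : ℤ) - ((j : ℕ) : ℤ) : ℤ) : ℝ) * θ)) =
        ∑ j : Fin M, v i * v j * (Real.pi * (K (((i : ℕ) : ℤ) - ((j : ℕ) : ℤ)) +
          K (-(((i : ℕ) : ℤ) - ((j : ℕ) : ℤ))))) := by
      intro i
      rw [intervalIntegral.integral_finsetSum (fun j _ => ?_)]
      · refine Finset.sum_congr rfl fun j _ => ?_
        rw [intervalIntegral.integral_const_mul, integral_cosSymbol_mul_cos hK]
      · exact ((hSc.mul (by fun_prop : Continuous fun θ : ℝ =>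
          Real.cos (((((i : ℕ) : ℤ) - ((j : ℕ) : ℤ) : ℤ) : ℝ) * θ))).const_mul _).intervalIntegrable _ _
    simp_rw [hinner, neg_sub]
    have hswap : ∑ i : Fin M, ∑ j : Fin M, v i * v j * K (((j : ℕ) : ℤ) - ((i : ℕ) : ℤ)) =
        ∑ i : Fin M, ∑ j : Fin M, v i * v j * K (((i : ℕ) : ℤ) - ((j : ℕ) : ℤ)) := by
      rw [Finset.sum_comm]
      refine Finset.sum_congr rfl fun i _ => Finset.sum_congr rfl fun j _ => ?_
      ring
    calc ∑ i : Fin M, ∑ j : Fin M, v i * v j * (Real.pi * (K (((i : ℕ) : ℤ) - ((j : ℕ) : ℤ)) +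
            K (((j : ℕ) : ℤ) - ((i : ℕ) : ℤ))))
        = Real.pi * ∑ i : Fin M, ∑ j : Fin M, v i * v j * K (((i : ℕ) : ℤ) - ((j : ℕ) : ℤ)) +
          Real.pi * ∑ i : Fin M, ∑ j : Fin M, v i * v j * K (((j : ℕ) : ℤ) - ((i : ℕ) : ℤ)) := by
          rw [Finset.mul_sum, Finset.mul_sum, ← Finset.sum_add_distrib]
          refine Finset.sum_congr rfl fun i _ => ?_
          rw [Finset.mul_sum, Finset.mul_sum, ← Finset.sum_add_distrib]
          refine Finset.sum_congr rfl fun j _ => ?_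
          ring
      _ = 2 * Real.pi * ∑ i : Fin M, ∑ j : Fin M, v i * K (((i : ℕ) : ℤ) - ((j : ℕ) : ℤ)) * v j := by
          rw [hswap, Finset.mul_sum, Finset.mul_sum, ← Finset.sum_add_distrib]
          refine Finset.sum_congr rfl fun i _ => ?_
          rw [Finset.mul_sum, Finset.mul_sum, ← Finset.sum_add_distrib]
          refine Finset.sum_congr rfl fun j _ => ?_
          ring
  · refine (continuous_finsetSum _ fun j _ => ?_).intervalIntegrable _ _
    exact (hSc.mul (by fun_prop : Continuous fun θ : ℝ =>
      Real.cos (((((i : ℕ) : ℤ) - ((j : ℕ) : ℤ) : ℤ) : ℝ) * θ))).const_mul _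

/-! ### The stub -/

/-- STUB `stub_toeplitzSymbol` of the crux skeleton (line `limit-operator-memory-form`) — TOEPLITZ SECTIONS ARE
BOUNDED BELOW BY THE BOTTOM OF THE SYMBOL. For a summable kernel `K : ℤ → ℝ` whose cosine symbol
`K̂(θ) = Σ'_z K(z)cos(zθ)` is `> 0` at EVERY `θ`, there is `m > 0` with `Σ_{i,j} v_i K(i−j) v_j ≥ m·|v|²` for every
finite section (all `M`, all `v : Fin M → ℝ`). Proof: `K̂` is continuous, so `m := min_{[0,2π]} K̂ = K̂(θ₀) > 0`
exists (compactness); with `P_v(θ) = Σ_{i,j} v_iv_j cos((i−j)θ) ≥ 0` one has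
`2π Σ_{i,j} v_i K(i−j) v_j = ∫₀^{2π} K̂ P_v ≥ m ∫₀^{2π} P_v = 2π m|v|²`.
[Halmos1982 Problem 250 / Solution 250 (Hartman–Wintner); Grenander–Szegő, Toeplitz Forms §5.2] -/
theorem stub_toeplitzSymbol : ∀ K : ℤ → ℝ, Summable K →
    (∀ θ : ℝ, 0 < ∑' z : ℤ, K z * Real.cos (z * θ)) →
    ∃ m : ℝ, 0 < m ∧ ∀ (M : ℕ) (v : Fin M → ℝ),
      m * ∑ i, v i ^ 2 ≤ ∑ i, ∑ j, v i * K ((i.val : ℤ) - j.val) * v j := by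
  intro K hK hpos
  have hSc := continuous_cosSymbol hK
  have h2π : (0 : ℝ) ≤ 2 * Real.pi := by positivity
  have h2π' : (0 : ℝ) < 2 * Real.pi := by positivity
  obtain ⟨θ₀, -, hmin⟩ := (isCompact_Icc : IsCompact (Set.Icc (0 : ℝ) (2 * Real.pi))).exists_isMinOn
    ⟨0, Set.left_mem_Icc.2 h2π⟩ hSc.continuousOn
  refine ⟨∑' z : ℤ, K z * Real.cos (z * θ₀), hpos θ₀, fun M v => ?_⟩
  have hPc : Continuous fun θ : ℝ => ∑ i : Fin M, ∑ j : Fin M,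
      v i * v j * Real.cos (((((i : ℕ) : ℤ) - ((j : ℕ) : ℤ) : ℤ) : ℝ) * θ) := by
    fun_prop
  have hle : ∫ θ in (0 : ℝ)..2 * Real.pi, (∑' z : ℤ, K z * Real.cos (z * θ₀)) *
        ∑ i : Fin M, ∑ j : Fin M, v i * v j * Real.cos (((((i : ℕ) : ℤ) - ((j : ℕ) : ℤ) : ℤ) : ℝ) * θ) ≤
      ∫ θ in (0 : ℝ)..2 * Real.pi, (∑' z : ℤ, K z * Real.cos (z * θ)) *
        ∑ i : Fin M, ∑ j : Fin M, v i * v j * Real.cos (((((i : ℕ) : ℤ) - ((j : ℕ) : ℤ) : ℤ) : ℝ) * θ) := by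
    refine intervalIntegral.integral_mono_on h2π ((hPc.const_mul _).intervalIntegrable _ _)
      ((hSc.mul hPc).intervalIntegrable _ _) fun θ hθ => ?_
    exact mul_le_mul_of_nonneg_right ((isMinOn_iff.1 hmin) θ hθ) (toeplitz_quadForm_cos_nonneg v θ)
  rw [intervalIntegral.integral_const_mul, integral_toeplitz_quadForm_cos,
    integral_cosSymbol_mul_toeplitz_quadForm hK] at hle
  have hle' : 2 * Real.pi * ((∑' z : ℤ, K z * Real.cos (z * θ₀)) * ∑ i : Fin M, v i ^ 2) ≤
      2 * Real.pi * ∑ i : Fin M, ∑ j : Fin M, v i * K (((i : ℕ) : ℤ) - ((j : ℕ) : ℤ)) * v j := by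
    calc 2 * Real.pi * ((∑' z : ℤ, K z * Real.cos (z * θ₀)) * ∑ i : Fin M, v i ^ 2)
        = (∑' z : ℤ, K z * Real.cos (z * θ₀)) * (2 * Real.pi * ∑ i : Fin M, v i ^ 2) := by ring
      _ ≤ _ := hle
  exact le_of_mul_le_mul_left hle' h2π'

end Summit.AtomisticToContinuum.FouriersLaw.Theorems.HonestZwanzig.Robin

end
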